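import Literature.MathematicalPhysics.QuantumFieldTheory.Balaban1983to89.B12SecondOrder267Concrete

/-!
# `Balaban1983to89.B11Eq56Coefficients` — T. Bałaban, *The variational problem and background fields in renormalization group method for
lattice gauge theories*, Commun. Math. Phys. **102** (1985) 277–309 [Balaban1985Variational], (55)–(56) p. 286: **THE TERMS OF THE POWER SERIES OF
THE CONCRETE FIXED POINT `D̃` ARE THE SLICE COEFFICIENTS, AND THE SECOND ONE IS `C⁽²⁾`** — for EVERY power series `p` of `D̃` at `A′ = 0` (such a `p`
exists, with `p₀ = p₁ = 0`: `B12SecondOrder267Concrete.p267_second_order_concrete` (ii), «a power series expansion of D(A′) begins with second order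
terms»), the `n`-th term on the diagonal is `p_n(A′, …, A′) = (n!)⁻¹·(dⁿ/dtⁿ)D̃(tA′)|_{t=0}` (the `D̃⁽ⁿ⁾(A′)` of `B11Eq56SeriesConcrete`), and
`p₂(A′, A′) = C⁽²⁾(A′, A′)` («For example we have on Λ_j D^{(2)}(A′) = C_j^{(2)}(LʲηA′)», after (56)) — the `D`-side companion of
`B7Eq136Coefficients`

statement-level skeleton of published theorems with citation tags; proofs where landed; nothing here is a claim about the Yang–Mills mass gap

v1.1 (p06 gen 17, 2026-08-22): DOCFIX ONLY — the «THE PRINT (p. 286)» quotation and the short quotations of the sentence after (56) re-typed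
VERBATIM from the page (render `…-p010-x2.png`, text layer `p0010.txt` L19–29): v1 carried «Especially we have D^{(2)}(A′) = C^{(2)}(LʲηA′)»
inside the guillemets where the print has «For example we have on Λ_j D^{(2)}(A′) = C_j^{(2)}(LʲηA′), …», and elided with «…» the printed
sentence «We can find this expression from Eq. (49) and the expansion (136) [4] of the function C_j:» — r08 `QUOTE-AUDIT-B11.md` §E item R2;
declarations byte-identical.

PDF held: `paper:balaban1985-cmp102-variational-background` (journal page = PDF page + 276); p. 286 [PDF 10], text layer `p0010.txt` (displays (55)–(56)
quoted from r08's transcription in `B11Eq56Expansion`'s header, re-read by this seat).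

CITATION HEADER / WHAT IS REPRODUCED.  Cell `lit-balaban`, Phase-2 proof seat p06 gen 6 = unit `lit-balaban-p06` (TAKING addendum HOME/STATUS.md
2026-08-21T18:14:13Z); SKELETON row **B11.Eq55** ((55)–(56); owner r08).  THE PRINT (p. 286, verbatim after (55)): *«This implies that a power
series expansion of D(A′) begins with second order terms. We can find this expression from Eq. (49) and the expansion (136) [4] of the function
C_j: C_j(LʲηA′ − LʲηHD(A′)) = Σ_{n=2}^∞ C_j^{(n)}(LʲηA′ − LʲηH Σ_{m=2}^∞ D^{(m)}(A′)) = Σ_{n=2}^∞ D^{(n)}(A′), (56) where C_j^{(n)}, D^{(n)} are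
homogeneous polynomials of nth order. From Eq. (56) a sequence of recursive equations for D^{(n)} follows. It can be solved easily. For example
we have on Λ_j D^{(2)}(A′) = C_j^{(2)}(LʲηA′), D^{(3)}(A′) = C_j^{(3)}(LʲηA′) − 2C_j^{(2)}(LʲηA′, LʲηHC^{(2)}(A′)), and so on. Here C_j^{(2)}(A′, A″)
denotes a symmetric bilinear form obtained by polarization from the quadratic form C_j^{(2)}(A), and C^{(2)}(A′) = C_j^{(2)}(LʲηA′) on Λ_j.»*
((49) p. 285: *«C_j(LʲηA′ − LʲηHD(A′)) = D(A′) on Λ_j.»*).  In the tree: existence of the power series with vanishing orders `0`, `1` and `D²D̃(0) = D²C̃(0)` is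
`p267_second_order_concrete` (r09's p. 267 [B12] reading, made concrete by this seat in gen 5); the named terms `D̃⁽ⁿ⁾` and the series on the whole
ball are `B11Eq56SeriesConcrete`.  This file identifies, for EVERY power series `p` of `D̃` at `0`, the diagonal values `p_n(A′, …, A′)` with the
slice coefficients and `p₂(A′, A′)` with `C2map A′ A′` — by Mathlib's `HasFPowerSeriesOnBall.factorial_smul` («the iterated derivative on
`(y, …, y)` is `n!` times the `n`-th term»).

DICTIONARY (as `B11Eq44Concrete` / `B12SecondOrder267Concrete`).  `D ↦ D̃ = Dt : 𝔸^S → 𝔸^T`, ANY map with the fixed-point characterization (49) +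
(55)-ball on `‖A′‖ < ε` (`hDfix`, `hDball`); `H ↦ hop` with `‖hop X‖ ≤ B₀‖X‖`; `D^{(n)}(A′) = p_n(A′, …, A′)` ↦ `p n (fun _ => A')`; `C_j^{(2)}(LʲηA′)`
(`= C^{(2)}(A′)` on `Λ_j`) ↦ `C2map L U₀ S T j A′ A′`; print's `C₂` ↦ `C₂(Lʲ)²`, `C₂ = 8·C₁·e^{4cα₀}` written out (no local notation).  Regime (§3 only) = `B11Eq44Concrete`'s with
«9C₂B₀ε₃ < 1» and `3ε ≤ b`.

WHAT THIS FILE PROVES (theorems only; kernel, 0 sorry, standard axioms):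
* §1 (generic, private) `coeff_diag_eq_slice`: `p n (a, …, a) = (n!)⁻¹·(dⁿ/dtⁿ)f(ta)|₀` for any `f` with a power series `p` at `0`.
* §2 **`powerSeries_Dt_diag_eq_slice_coeff`** (every power series `p` of ANY map `Dt` at `0`: `p n (A′, …, A′) = (n!)⁻¹·(dⁿ/dtⁿ)D̃(tA′)|₀`; no regime),
  `powerSeries_Dt_diag_unique`.
* §3 **IN THE REGIME**: **`powerSeries_Dt_diag_two`** (`p₂(A′, A′) = C2map A′ A′` for every power series `p` of the concrete `D̃` at `0` —
  `p267_second_order_concrete` (iii) + `factorial_smul` + `B11Eq44Concrete.C2map_self`), **`p267_powerSeries_terms`** (`∃ p`: power series of `D̃` at `0`,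
  `p₀ = 0`, `p₁ = 0`, `p₂(A′, A′) = C2map A′ A′`, `p_n(A′, …, A′) = (n!)⁻¹(dⁿ/dtⁿ)D̃(tA′)|₀` — (55)–(56) in power-series language with the terms named).
NOT CLAIMED: `p₃` = the printed `D^{(3)}` (ray argument with `B11Eq56Order3Concrete`, left to `B11Eq56SeriesConcrete`'s sequel); radii.  NOT summit progress.
-/

noncomputable section

open scoped BigOperators Topology Nat
open NormedSpace Finset Metric Filter

namespace Literature.MathematicalPhysics.QuantumFieldTheory.Balaban1983to89.B11Eq56Coefficients

open B7Prop1Explicit B7Prop1Local B7Prop2Explicit B7Prop3Flat B7Prop4Flat B7Eq92Concrete B7Prop3GeneralLinear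
  B7Prop4GeneralLevels B7Prop5GeneralLevels B7Eq136SecondOrder B13Contraction113 B11Eq44Concrete B12SecondOrder267Concrete

-- `Site` alone would resolve to the torus sites of `Setup.lean`; re-export the `ℤ^d` sites of `B7Prop1Explicit`.
export B7Prop1Explicit (Site)

variable {d : ℕ}

/-! ## §1 Taylor terms on the diagonal are slice derivatives (generic, private) -/

section Generic

variable {E F : Type*} [NormedAddCommGroup E] [NormedSpace ℂ E] [NormedAddCommGroup F] [NormedSpace ℂ F] [CompleteSpace F]

/-- for `f` with a power series `p` at `0` and any vector `a`: `p n (a, …, a) = (n!)⁻¹·(dⁿ/dtⁿ)f(t·a)|_{t=0}` (the slice `t ↦ f(ta)` has the power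
series `p.compContinuousLinearMap (t ↦ ta)`; Mathlib `HasFPowerSeriesOnBall.factorial_smul`). [folklore] -/
private theorem coeff_diag_eq_slice {f : E → F} {p : FormalMultilinearSeries ℂ E F} (hp : HasFPowerSeriesAt f p 0) (a : E) (n : ℕ) :
    p n (fun _ => a) = ((n ! : ℕ) : ℂ)⁻¹ • iteratedDeriv n (fun t : ℂ => f (t • a)) 0 := by
  obtain ⟨r, hr⟩ := hp
  set u : ℂ →L[ℂ] E := ContinuousLinearMap.toSpanSingleton ℂ a with hu
  have hu0 : u 0 = 0 := by simp [hu]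
  have hr' : HasFPowerSeriesOnBall f p (u 0) r := by rwa [hu0]
  have hg := hr'.compContinuousLinearMap
  have h1 := hg.factorial_smul (1 : ℂ) n
  rw [FormalMultilinearSeries.compContinuousLinearMap_apply, iteratedFDeriv_apply_eq_iteratedDeriv_mul_prod,
    Finset.prod_const_one, one_smul] at h1
  have hcomp : (u ∘ fun _ : Fin n => (1 : ℂ)) = fun _ => a := by
    funext i
    simp [hu]
  have hfun : (f ∘ u) = fun t : ℂ => f (t • a) := by
    funext t
    simp [hu]
  rw [hcomp, hfun] at h1
  rw [← h1, ← Nat.cast_smul_eq_nsmul ℂ, smul_smul, inv_mul_cancel₀ (by exact_mod_cast (Nat.factorial_ne_zero n)), one_smul]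

end Generic

/-! ## §2 The terms of a power series of `D̃` on the diagonal -/

section Bridge

variable {𝔸 : Type*} [NormedRing 𝔸] [NormedAlgebra ℂ 𝔸] [CompleteSpace 𝔸] {S T : Finset (Site d × Fin d)}

/-- **THE `n`-TH TERM OF ANY POWER SERIES OF `D̃` AT `0`, ON THE DIAGONAL, IS THE `tⁿ`-COEFFICIENT OF THE SLICE**: `p_n(A′, …, A′) =
(n!)⁻¹·(dⁿ/dtⁿ)D̃(tA′)|_{t=0}` — the homogeneous polynomial «D^{(n)}(A′)» of (56) (= `B11Eq56SeriesConcrete.DtN Dt A′ n` by definition); no regime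
hypothesis, for any map `Dt : 𝔸^S → 𝔸^T` with a power series at `0`. [cite: Balaban1985Variational, (56) p.286] -/
theorem powerSeries_Dt_diag_eq_slice_coeff {Dt : (S → 𝔸) → (T → 𝔸)} {p : FormalMultilinearSeries ℂ (S → 𝔸) (T → 𝔸)}
    (hp : HasFPowerSeriesAt Dt p 0) (A' : S → 𝔸) (n : ℕ) :
    p n (fun _ => A') = ((n ! : ℕ) : ℂ)⁻¹ • iteratedDeriv n (fun t : ℂ => Dt (t • A')) 0 :=
  coeff_diag_eq_slice hp A' n

/-- the diagonal values `p_n(A′, …, A′)` — the homogeneous polynomials «D^{(n)}» — do not depend on the chosen power series.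
[cite: Balaban1985Variational, (56) p.286] -/
theorem powerSeries_Dt_diag_unique {Dt : (S → 𝔸) → (T → 𝔸)} {p q : FormalMultilinearSeries ℂ (S → 𝔸) (T → 𝔸)}
    (hp : HasFPowerSeriesAt Dt p 0) (hq : HasFPowerSeriesAt Dt q 0) (A' : S → 𝔸) (n : ℕ) :
    p n (fun _ => A') = q n (fun _ => A') := by
  rw [powerSeries_Dt_diag_eq_slice_coeff hp A' n, powerSeries_Dt_diag_eq_slice_coeff hq A' n]

end Bridge

/-! ## §3 In the regime: `p₂(A′, A′) = C⁽²⁾(A′, A′)` and (55)–(56) with the terms named -/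

section Regime

variable {𝔸 : Type*} [NormedRing 𝔸] [NormedAlgebra ℂ 𝔸] [CompleteSpace 𝔸] [NormOneClass 𝔸]

variable (L : ℕ) (hL : 2 ≤ L) {G : Subgroup 𝔸ˣ} (hG : AvgClosed d L G) (k : ℕ)
  (U₀ : Site d → Fin d → 𝔸ˣ) (hU₀ : ∀ x κ, U₀ x κ ∈ G) {α₀ : ℝ} (hα : 0 < α₀)
  (hα3 : C0 d * α₀ ≤ 1 / 3) (hα4 : 4 * α₀ ≤ c2' d L) (h52 : pdev U₀ < α₀ * (((L : ℝ) ^ k)⁻¹) ^ 2)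
  {b : ℝ} (hb : 0 < b)
  (hsmall : Real.exp (4 * (800 * ((d : ℝ) + 1) ^ 2 * ((d : ℝ) + 4)) * α₀)
    * (1 + 8 * (131072 * ((d : ℝ) + 1) ^ 2) * ((L : ℝ) ^ k * b)) ≤ 2)
  (hc₃ : 4 * ((L : ℝ) ^ k * b) < c3 d L)
  (S T : Finset (Site d × Fin d)) (hop : (T → 𝔸) →ₗ[ℂ] (S → 𝔸)) {B₀ ε : ℝ} {Dt : (S → 𝔸) → (T → 𝔸)}

include hL hG hU₀ hα hα3 hα4 h52 hb hsmall hc₃ in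
/-- **«FOR EXAMPLE WE HAVE ON Λ_j D^{(2)}(A′) = C_j^{(2)}(LʲηA′)» (THE SENTENCE AFTER (56)) FOR EVERY POWER SERIES OF THE CONCRETE `D̃`**: if `p` is
a power series at `0` of a map `D̃`
with the fixed-point characterization (49) + (55)-ball on `‖A′‖ < ε` (regime of `B11Eq44Concrete`, «9C₂B₀ε₃ < 1», `3ε ≤ b`), then
`p₂(A′, A′) = C2map A′ A′` for every `A′ ∈ 𝔸^S` — `2!·p₂(A′, A′) = D²D̃(0)(A′, A′)` (Mathlib `factorial_smul`) `= D²C̃(0)(A′, A′)`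
(`p267_second_order_concrete` (iii)) `= 2·C_j⁽²⁾(U₀, ins_S A′) = 2·C2map A′ A′` (`B11Eq44Concrete.C2map_self`).
[cite: Balaban1985Variational, (56) p.286] [cite: Balaban1985Averaging, (136) p.39] -/
theorem powerSeries_Dt_diag_two {j : ℕ} (hj : j ≤ k) (hB₀ : 0 ≤ B₀) (hHop : ∀ X, ‖hop X‖ ≤ B₀ * ‖X‖)
    (hq : 9 * ((8 * (131072 * ((d : ℝ) + 1) ^ 2) * Real.exp (4 * (800 * ((d : ℝ) + 1) ^ 2 * ((d : ℝ) + 4)) * α₀))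
      * ((L : ℝ) ^ j) ^ 2) * B₀ * ε < 1) (hε : 3 * ε ≤ b) (hε0 : 0 < ε)
    (hDball : ∀ B : S → 𝔸, ‖B‖ < ε → Dt B ∈ closedBall (0 : T → 𝔸)
      (4 * ((8 * (131072 * ((d : ℝ) + 1) ^ 2) * Real.exp (4 * (800 * ((d : ℝ) + 1) ^ 2 * ((d : ℝ) + 4)) * α₀))
        * ((L : ℝ) ^ j) ^ 2) * ε ^ 2))
    (hDfix : ∀ B : S → 𝔸, ‖B‖ < ε → Cmap L U₀ S T j (B - hop (Dt B)) = Dt B)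
    {p : FormalMultilinearSeries ℂ (S → 𝔸) (T → 𝔸)} (hp : HasFPowerSeriesAt Dt p 0) (A' : S → 𝔸) :
    p 2 (fun _ => A') = C2map L U₀ S T j A' A' := by
  obtain ⟨-, -, ⟨-, hdiag⟩, -, -⟩ :=
    p267_second_order_concrete L hL hG k U₀ hU₀ hα hα3 hα4 h52 hb hsmall hc₃ S T hop hj hB₀ hHop hq hε hε0 hDball hDfix
  obtain ⟨r, hr⟩ := hp
  have hfac := hr.factorial_smul A' 2
  -- `2!·p₂(A′, A′) = D²D̃(0)(A′, A′)`, and `½D²D̃(0)(A′, A′) = (C_j⁽²⁾(U₀, ins_S A′)(c))_c = C2map A′ A′`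
  have h2 : p 2 (fun _ => A') = (2 : ℂ)⁻¹ • iteratedFDeriv ℂ 2 Dt (0 : S → 𝔸) (fun _ => A') := by
    rw [← hfac, ← Nat.cast_smul_eq_nsmul ℂ, smul_smul]
    norm_num [Nat.factorial]
  rw [h2, hdiag A', C2map_self L hL hG k U₀ hU₀ hα hα3 hα4 h52 hb hsmall hc₃ S T hj A']

include hL hG hU₀ hα hα3 hα4 h52 hb hsmall hc₃ in
/-- **(55)–(56) IN POWER-SERIES LANGUAGE WITH THE TERMS NAMED, FOR THE CONCRETE `D̃`**: there is a power series `p` of `D̃` at `0` («an analytic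
function of A′») with `p₀ = 0`, `p₁ = 0` («a power series expansion of D(A′) begins with second order terms»), `p₂(A′, A′) = C2map A′ A′` («For example we
have on Λ_j D^{(2)}(A′) = C_j^{(2)}(LʲηA′)») and `p_n(A′, …, A′) = (n!)⁻¹(dⁿ/dtⁿ)D̃(tA′)|₀` for every `n` (the homogeneous polynomials «D^{(n)}»).
[cite: Balaban1985Variational, (55)–(56) p.286, (54) p.286] -/
theorem p267_powerSeries_terms {j : ℕ} (hj : j ≤ k) (hB₀ : 0 ≤ B₀) (hHop : ∀ X, ‖hop X‖ ≤ B₀ * ‖X‖)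
    (hq : 9 * ((8 * (131072 * ((d : ℝ) + 1) ^ 2) * Real.exp (4 * (800 * ((d : ℝ) + 1) ^ 2 * ((d : ℝ) + 4)) * α₀))
      * ((L : ℝ) ^ j) ^ 2) * B₀ * ε < 1) (hε : 3 * ε ≤ b) (hε0 : 0 < ε)
    (hDball : ∀ B : S → 𝔸, ‖B‖ < ε → Dt B ∈ closedBall (0 : T → 𝔸)
      (4 * ((8 * (131072 * ((d : ℝ) + 1) ^ 2) * Real.exp (4 * (800 * ((d : ℝ) + 1) ^ 2 * ((d : ℝ) + 4)) * α₀))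
        * ((L : ℝ) ^ j) ^ 2) * ε ^ 2))
    (hDfix : ∀ B : S → 𝔸, ‖B‖ < ε → Cmap L U₀ S T j (B - hop (Dt B)) = Dt B) :
    ∃ p : FormalMultilinearSeries ℂ (S → 𝔸) (T → 𝔸),
      HasFPowerSeriesAt Dt p 0 ∧ p 0 = 0 ∧ p 1 = 0 ∧
        ∀ A' : S → 𝔸, p 2 (fun _ => A') = C2map L U₀ S T j A' A' ∧
          ∀ n : ℕ, p n (fun _ => A') = ((n ! : ℕ) : ℂ)⁻¹ • iteratedDeriv n (fun t : ℂ => Dt (t • A')) 0 := by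
  obtain ⟨-, ⟨⟨p, hp⟩, h01⟩, -, -, -⟩ :=
    p267_second_order_concrete L hL hG k U₀ hU₀ hα hα3 hα4 h52 hb hsmall hc₃ S T hop hj hB₀ hHop hq hε hε0 hDball hDfix
  obtain ⟨h0, h1⟩ := h01 p hp
  exact ⟨p, hp, h0, h1, fun A' =>
    ⟨powerSeries_Dt_diag_two L hL hG k U₀ hU₀ hα hα3 hα4 h52 hb hsmall hc₃ S T hop hj hB₀ hHop hq hε hε0 hDball hDfix hp A',
      fun n => powerSeries_Dt_diag_eq_slice_coeff hp A' n⟩⟩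

end Regime

end Literature.MathematicalPhysics.QuantumFieldTheory.Balaban1983to89.B11Eq56Coefficients

end
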